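import Mathlib
import Summits.Ventures.HodgeRepro.Tier4.Common.AdelicDefs
import Summits.Ventures.HodgeRepro.Tier4.Line1.PlaneDefs
import Summits.Ventures.HodgeRepro.Tier4.Line1.StabLine
import Summits.Ventures.HodgeRepro.Tier4.Line1.TorusElement

/-!
# Tier4/Line1/TorusPlaneData — projector pairs of a genuine plane and their torus data (the rational half of the
TORUS BRIDGE (I1-c′)/(I1-c″) ⇐ hstab rung (ii))

Blind re-derivation cell `pub-hodge-repro`, Tier 4 (README §9–§10), seat t4-L1-p5 (prover, LINE L1, gen 2).
A projector pair `P` of the plane (`P 0 + P 1 = 1`, idempotent, commuting with `Ω`, `B`-self-adjoint in the row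
convention, rank `2` — the `P`- or `Q`-conjuncts of `PlaneData` + `IsGenuineRow`) has non-zero rational row vectors
`v` on `im (P 0)` and `w` on `im (P 1)` (non-zero rows of the projectors), the two lines are `B`-orthogonal and
`Ω`-stable, and `(P 0)ᵀ` fixes the line of `v` and kills the line of `w`: this is exactly the `Rot.TorusData` of
`Tier4/Line1/TorusElement.lean` in the column picture (`B`, `Om = Ωᵀ`, `P = (P 0)ᵀ`), built by `planeTorusData`.
`Tier4/Line1/TorusCocompact.lean` consumes it.  Mathlib + the line's modules only; no printed input.

Nothing here says anything about the status of the Hodge conjecture for CM abelian varieties, which is NOT proved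
(HC_CM is NOT proved by anyone in this repository).
-/

set_option autoImplicit false

noncomputable section

namespace Summit.Ventures.HodgeRepro.Tier4.Line1

open NumberField MeasureTheory Summit.Ventures.HodgeRepro.Tier4.Common Matrix Rot

variable {k : Type} [Field k] [NumberField k] (W : PlaneData k)

/-- **a projector pair of the plane**: the five properties shared by `W.P` and `W.Q` of a genuine plane
(`PlaneData` fields + the `IsGenuineRow` conjuncts). -/
structure ProjPair (P : Fin 2 → Matrix (Fin 4) (Fin 4) k) : Prop where
  /-- the projectors commute with `Ω` -/
  comm : ∀ i, P i * W.Ω = W.Ω * P i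
  /-- idempotent -/
  idem : ∀ i, P i * P i = P i
  /-- complementary -/
  sum : P 0 + P 1 = 1
  /-- `B`-self-adjoint in the row convention -/
  adj : ∀ i, P i * W.B = W.B * (P i)ᵀ
  /-- of rank `2` -/
  rank : ∀ i, (P i).rank = 2

omit [NumberField k] in
/-- the `P`-pair of a genuine plane -/
theorem projPair_P (hg : IsGenuineRow W) : ProjPair W W.P :=
  ⟨W.P_comm, W.P_idem, W.P_sum, hg.2.2.1, hg.2.2.2.2.1⟩

omit [NumberField k] in
/-- the `Q`-pair of a genuine plane -/
theorem projPair_Q (hg : IsGenuineRow W) : ProjPair W W.Q :=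
  ⟨W.Q_comm, W.Q_idem, W.Q_sum, hg.2.2.2.1, hg.2.2.2.2.2⟩

section Rows

variable {W}

omit [NumberField k] in
/-- a non-zero idempotent matrix has a non-zero row fixed by it (a non-zero row of `P` itself) -/
theorem exists_row_ne_zero {P : Matrix (Fin 4) (Fin 4) k} (hP : P.rank = 2) (hidem : P * P = P) :
    ∃ v : Fin 4 → k, v ≠ 0 ∧ v ᵥ* P = v := by
  have hP0 : P ≠ 0 := by
    rintro rfl
    rw [Matrix.rank_zero] at hP
    exact absurd hP (by norm_num)
  obtain ⟨i, hi⟩ : ∃ i, P i ≠ 0 := by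
    by_contra h
    exact hP0 (funext fun i => not_not.mp (not_exists.mp h i))
  refine ⟨P i, hi, ?_⟩
  funext j
  have := congrFun (congrFun hidem i) j
  rw [← this, Matrix.mul_apply, Matrix.vecMul, dotProduct]

omit [NumberField k] in
/-- `P 1 * P 0 = 0` for a projector pair -/
theorem ProjPair.mul_zero' {P : Fin 2 → Matrix (Fin 4) (Fin 4) k} (hP : ProjPair W P) : P 1 * P 0 = 0 := by
  have h : P 1 = 1 - P 0 := by rw [← hP.sum]; abel
  rw [h, sub_mul, one_mul, hP.idem 0, sub_self]

omit [NumberField k] in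
/-- `P 0 * P 1 = 0` for a projector pair -/
theorem ProjPair.mul_zero {P : Fin 2 → Matrix (Fin 4) (Fin 4) k} (hP : ProjPair W P) : P 0 * P 1 = 0 := by
  have h : P 1 = 1 - P 0 := by rw [← hP.sum]; abel
  rw [h, mul_sub, mul_one, hP.idem 0, sub_self]

omit [NumberField k] in
/-- orthogonality of the two lines (column picture, as t4-L1-p3's `pair_eq_zero_of_lines`): if `(P 0)ᵀ u = u` and
`(P 1)ᵀ w = w` then `β(u, w) = 0`. -/
theorem ProjPair.pair_eq_zero {P : Fin 2 → Matrix (Fin 4) (Fin 4) k} (hP : ProjPair W P) {u w : Fin 4 → k}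
    (hu : (P 0)ᵀ *ᵥ u = u) (hw : (P 1)ᵀ *ᵥ w = w) : u ⬝ᵥ (W.B *ᵥ w) = 0 := by
  calc u ⬝ᵥ (W.B *ᵥ w) = ((P 0)ᵀ *ᵥ u) ⬝ᵥ (W.B *ᵥ ((P 1)ᵀ *ᵥ w)) := by rw [hu, hw]
    _ = u ⬝ᵥ ((P 0 * W.B * (P 1)ᵀ) *ᵥ w) := by
        rw [mulVec_transpose, ← dotProduct_mulVec]
        simp only [mulVec_mulVec, Matrix.mul_assoc]
    _ = 0 := by
        rw [hP.adj 0, Matrix.mul_assoc, ← Matrix.transpose_mul, hP.mul_zero', Matrix.transpose_zero,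
          Matrix.mul_zero, zero_mulVec, dotProduct_zero]

omit [NumberField k] in
/-- the line of `P i` is `Ωᵀ`-stable (column picture) -/
theorem ProjPair.mulVec_Ω {P : Fin 2 → Matrix (Fin 4) (Fin 4) k} (hP : ProjPair W P) (i : Fin 2)
    {u : Fin 4 → k} (hu : (P i)ᵀ *ᵥ u = u) : (P i)ᵀ *ᵥ (W.Ωᵀ *ᵥ u) = W.Ωᵀ *ᵥ u := by
  rw [mulVec_mulVec, ← Matrix.transpose_mul, ← hP.comm i, Matrix.transpose_mul, ← mulVec_mulVec, hu]

omit [NumberField k] in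
/-- a vector of the second line is killed by `(P 0)ᵀ` -/
theorem ProjPair.mulVec_eq_zero {P : Fin 2 → Matrix (Fin 4) (Fin 4) k} (hP : ProjPair W P) {w : Fin 4 → k}
    (hw : (P 1)ᵀ *ᵥ w = w) : (P 0)ᵀ *ᵥ w = 0 := by
  rw [← hw, mulVec_mulVec, ← Matrix.transpose_mul, hP.mul_zero', Matrix.transpose_zero, zero_mulVec]

end Rows

section Data

/-- **the torus data of a projector pair** (column picture: `B`, `Om = Ωᵀ`, `P = (P 0)ᵀ`, the discriminant `d` of
`IsGenuineRow`, a rational vector `v ≠ 0` of the first line and `w ≠ 0` of the second) -/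
def planeTorusData (hW : IsDefinite W) {d : k} (hΩ : W.Ω * W.Ω = -(d • (1 : Matrix (Fin 4) (Fin 4) k)))
    (hd : ¬ IsSquare (-d)) (hrow : W.Ω * W.B = -(W.B * W.Ωᵀ)) {P : Fin 2 → Matrix (Fin 4) (Fin 4) k}
    (hP : ProjPair W P) {v w : Fin 4 → k} (hv : v ≠ 0) (hw : w ≠ 0) (hv0 : v ᵥ* P 0 = v)
    (hw1 : w ᵥ* P 1 = w) : TorusData k where
  B := W.B
  Om := W.Ωᵀ
  P := (P 0)ᵀ
  d := d
  v := v
  w := w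
  hB := W.B_symm
  hherm := by rw [Matrix.transpose_transpose]; exact hrow
  hOm := by
    rw [← Matrix.transpose_mul, hΩ, Matrix.transpose_neg, Matrix.transpose_smul, Matrix.transpose_one]
  hd := hd
  hdef := fun u hu => pair_self_ne_zero_of_isDefinite W hW hu
  hv := hv
  hw := hw
  hwv := by
    have hv' : (P 0)ᵀ *ᵥ v = v := by rw [mulVec_transpose]; exact hv0
    have hw' : (P 1)ᵀ *ᵥ w = w := by rw [mulVec_transpose]; exact hw1
    rw [pair_comm W.B_symm]
    exact hP.pair_eq_zero hv' hw'
  hwOv := by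
    have hv' : (P 0)ᵀ *ᵥ v = v := by rw [mulVec_transpose]; exact hv0
    have hw' : (P 1)ᵀ *ᵥ w = w := by rw [mulVec_transpose]; exact hw1
    rw [pair_comm W.B_symm]
    exact hP.pair_eq_zero (hP.mulVec_Ω 0 hv') hw'
  hPv := by rw [mulVec_transpose]; exact hv0
  hPOv := by
    have hv' : (P 0)ᵀ *ᵥ v = v := by rw [mulVec_transpose]; exact hv0
    exact hP.mulVec_Ω 0 hv'
  hPw := by
    have hw' : (P 1)ᵀ *ᵥ w = w := by rw [mulVec_transpose]; exact hw1
    exact hP.mulVec_eq_zero hw'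
  hPOw := by
    have hw' : (P 1)ᵀ *ᵥ w = w := by rw [mulVec_transpose]; exact hw1
    exact hP.mulVec_eq_zero (hP.mulVec_Ω 1 hw')

end Data

end Summit.Ventures.HodgeRepro.Tier4.Line1

end
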